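import Literature.Geometry.Kaehler.ComplexTorusMumfordTateGroupHodgeCircleSigmaPiComplexPoints
import HarnessLib

/-!
# The REAL points of the Mumford–Tate group of the mixed family: `MT(E × ∏ₖ X_k)(ℝ) = {(B 0; 0 diag_k h_k(z_{d(k)})) :
# B ∈ GL₂(ℝ), z ∈ (ℂ^×)^R, det B = |z_i|² for every Hom-class i}` for a one-dimensional torus `E` with `End_ℚ(E) = ℚ`
# and a finite family of tori `X_k` on the Hodge-circle locus — the real form of `ℂ^× · (SL₂(ℂ) × 𝔾_m(ℂ)^R)` cut out by the
# common multiplier (Imai 1976 §2 Proposition, §3 Remarks; Moonen–Zarhin 1999 §3 Theorem (2); Lange 2023 Remark 7.2.2 (2))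

Layer `Literature/Geometry/Kaehler`, namespace `Literature.Geometry.Kaehler.ComplexTorus`; lane `lit-hodgefound`
(Track 2 foundations library), Layer A3/A4 (Mumford–Tate groups; CM abelian varieties); prover seat `lit-hodgefound-p17`
(generation 35, self-proposed row g35-#6 = the point left open by g35-#2: the REAL Mumford–Tate group of `E × ∏ₖ X_k`, which
the multiplier relation alone does not determine). Sequel, BY NAME and without restating anything, of g35-#5
`ComplexTorusMumfordTateGroupHodgeCircleSigmaPiComplexPoints` (`mem_mumfordTateGroupC_prod_sigmaPiPeriod_iff_exists_of_homColouring`: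
`MT(E × ∏ₖ X_k)(ℂ) = ℂ^× · (SL₂(ℂ) × {diag_k ν_k(u_{d(k)})})`), of p22's `ComplexTorusMumfordTateGroup`
(`map_ofRealHom_mem_mumfordTateGroupC_iff`: `MT(ℝ) = MT(ℂ) ∩ GL(V_ℝ)`, `coe_generalLinearGroup_map_ofRealHom`) and
`ComplexTorusMumfordTateGroupCocharacter` (`hodgeSC_conj`: `h_ℂ(z, z̄) = h(z) ⊗ 1`, `map_conj_hodgeSC`, `hodgeSC_self`,
`hodgeSC_mul`, `hodgeSC_inv`), of `ComplexTorusMumfordTateGroupMaximalTorus` (`hodgeSC_sub_hodgeSC`), of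
`ComplexTorusMumfordTateGroupIrreducible` (`coe_scalar_mul_toGL`), of `ComplexTorusEllipticCurveHodgeGroupComplexPoints`
(`jMatrixC_mul_jMatrixC`; its `hodgeSC_injective` is the `2 × 2` case of §1) and of `ComplexTorusHodgeGroup` (`det_map_ofRealHom`).
THEOREMS ONLY (no definition, no instance, no named fact; D-0026 net debt 0).

## The argument

By `MT(ℝ) = MT(ℂ) ∩ GL(V_ℝ)` and g35-#5, `g ∈ MT(E × ∏ₖ X_k)(ℝ)` iff `g ⊗ 1 = α · (A 0; 0 diag_k ν_k(u_{d(k)}))` with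
`α ∈ ℂ^×`, `A ∈ SL₂(ℂ)`, `u ∈ (ℂ^×)^R`. Blockwise: `g₁₂ = g₂₁ = 0`; `g₁₁ ⊗ 1 = αA`, so `det g₁₁ = α²`; and the `k`-th block
`α ν_k(u_i) = h_{ℂ,k}(αu_i, αu_i⁻¹)` (`i = d(k)`) is REAL, which by §1 (`h_ℂ(z, w)` real ⟺ `w = z̄`, as `1, J_ℂ` are
independent and `J` is real) forces `αu_i⁻¹ = \overline{αu_i}`, i.e. with `z_i = αu_i`: `α² = z_i z̄_i = |z_i|²` and the block is
`h_k(z_i) ⊗ 1`. Conversely for `det B = |z_i|²` pick `α` with `α² = det B` (`ℂ` algebraically closed), `A = α⁻¹B`, `u_i = z_i/α`.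

## Sources, verbatim

* H. Imai, *On the Hodge groups of some abelian varieties*, Kōdai Math. Sem. Rep. 27 (1976), §2 Proposition (p. 368 L11–L13),
  last case (p. 370 L10–L19); §3 Remarks (p. 370 L38–L40, p. 371 L5–L7): "if `E` is not isogenous to any `E_i^{(j)}` …
  `Hg(E × A) = Hg(E) × Hg(A)`".
* B. Moonen, Yu. G. Zarhin, Math. Ann. 315 (1999), §3 Theorem (Hazama) (2) (held `paper:arxiv-math_9901113`, p0006 L70–L76);
  §2 (2.2): "`MT(X) = T_F`, `Hg(X) = U_F`" for Type IV(1,1).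
* H. Lange, *Abelian Varieties over the Complex Numbers* (2023), §7.2.1 Remark 7.2.2 (2): "`(𝔾_m · Hg(X))(ℂ) = {α · M ∈ GL(V_ℂ) |
  α ∈ ℂ*, M ∈ Hg(X)(ℂ)}`"; §7.2.1 (p. 329) "`MT(X)` is the smallest `ℚ`-algebraic subgroup of `GL(V)` … `h(ℂ*) ⊆ MT(X)(ℝ)`".
* B. Moonen, *An introduction to Mumford–Tate groups* (2004), (3.2) ("on the real points `S(ℝ) = ℂ^*` … `(z, z̄)`"), §4 (4.1), (4.6).
* J. Carlson, S. Müller-Stach, C. Peters, *Period Mappings and Period Domains* (2017), §15.2 Problem 15.2.3 (a), (c) and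
  Examples 15.2.4 (ii) ("`MT(H¹(C))(ℚ) = Res_{K/ℚ} K^×`").

## What is proved (`h_{ℂ} = hodgeSC`, `h = hodgeS`, `J_ℂ = J ⊗ 1`)

* §1 (ANY torus, `ι` non-empty): **`smul_one_add_smul_jMatrixC_eq_zero_iff`** (`a·1 + b·J_ℂ = 0 ⟺ a = b = 0`),
  **`hodgeSC_eq_hodgeSC_iff`** (`h_ℂ(z, w) = h_ℂ(z', w') ⟺ (z, w) = (z', w')`, any dimension),
  **`eq_conj_of_hodgeSC_eq_map_ofRealHom`** (`h_ℂ(z, w)` real ⟹ `w = z̄`), `hodgeSC_eq_map_ofRealHom_iff`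
  (`h_ℂ(z, w) = X ⊗ 1 ⟺ w = z̄ ∧ X = h(z)`), `smul_complexCircle_eq_hodgeSC` (`α · ν(u) = h_ℂ(αu, αu⁻¹)`).
* §2 THE MIXED FAMILY, REAL POINTS: **`mem_mumfordTateGroup_prod_sigmaPiPeriod_iff_exists_of_homColouring`**:
  `g ∈ MT(E × ∏ₖ X_k)(ℝ) ⟺ g = (B 0; 0 diag_k h_k(z_{d(k)}))` with `det B = |z_i|²` for all `i` (`End_ℚ(E) = ℚ`; `X_k` on the
  locus with a `Hom`-colouring `d`), and the `E_τ` (`End = ℤ`) specialisation.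

## References

* [Imai1976HodgeGroups] H. Imai, Kōdai Math. Sem. Rep. 27 (1976), §2 Proposition, §3 Remarks (pp. 370–371).
* [MoonenZarhin1999LowDim] B. Moonen, Yu. Zarhin, Math. Ann. 315 (1999), §2 (2.2), §3 Theorem (2), §3 Corollary.
* [Lange2023AbelianVarietiesComplex] H. Lange (2023), §7.2.1 and Remark 7.2.2 (2).
* [Moonen2004MT] B. Moonen (2004), (3.2), §4 (4.1), (4.6).
* [CarlsonMullerStachPeters2017] J. Carlson, S. Müller-Stach, C. Peters (2017), §15.2 Problem 15.2.3, Examples 15.2.4 (ii).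
-/

noncomputable section

open scoped Real MatrixGroups ComplexConjugate
open Complex Module Matrix Function

namespace Literature.Geometry.Kaehler

namespace ComplexTorus

/-! ## §1 `1` and `J_ℂ` are independent; `h_ℂ` is injective; real values of `h_ℂ` -/

section HodgeSC

variable {ι : Type*} [Fintype ι] [DecidableEq ι] {E : Type*} [NormedAddCommGroup E] [NormedSpace ℂ E]
  (Φ : (ι → ℝ) ≃L[ℝ] E)

/-- **`a·1 + b·J_ℂ = 0 ⟺ a = b = 0`** (`ι ≠ ∅`): `1` and `J_ℂ = J ⊗ 1` are linearly independent over `ℂ`, since `J` is REAL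
with `J² = −1` (a real scalar `c` with `c² = −1` does not exist). [cite: Lange2023AbelianVarietiesComplex, §7.1.1 Prop. 7.1.1 (`J² = -1`)]
[cite: Moonen2004MT, (3.2)] -/
theorem smul_one_add_smul_jMatrixC_eq_zero_iff [Nonempty ι] {a b : ℂ} :
    a • (1 : Matrix ι ι ℂ) + b • (jMatrix Φ).map Complex.ofRealHom = 0 ↔ a = 0 ∧ b = 0 := by
  refine ⟨fun h ↦ ?_, fun hab ↦ by rw [hab.1, hab.2, zero_smul, zero_smul, add_zero]⟩
  obtain ⟨i⟩ := ‹Nonempty ι›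
  have hii : a + b * (jMatrix Φ i i : ℂ) = 0 := by
    have e := congrFun (congrFun h i) i
    simpa [Matrix.add_apply, Matrix.smul_apply, Matrix.map_apply] using e
  by_cases hb : b = 0
  · rw [hb, zero_mul, add_zero] at hii
    exact ⟨hii, hb⟩
  · exfalso
    set c : ℝ := jMatrix Φ i i with hc
    have ha : a = -(b * c) := eq_neg_of_add_eq_zero_left hii
    -- `J_ℂ = c · 1` with `c` real
    have hY : b • ((jMatrix Φ).map Complex.ofRealHom - (c : ℂ) • (1 : Matrix ι ι ℂ)) = 0 := by
      rw [smul_sub, smul_smul, sub_eq_add_neg, ← neg_smul, add_comm, ← ha]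
      exact h
    have hJ : (jMatrix Φ).map Complex.ofRealHom = (c : ℂ) • (1 : Matrix ι ι ℂ) := by
      have h' := congrArg (fun X : Matrix ι ι ℂ ↦ b⁻¹ • X) hY
      simp only [smul_smul, inv_mul_cancel₀ hb, one_smul, smul_zero] at h'
      exact sub_eq_zero.1 h'
    -- `c² = -1` with `c` real: impossible
    have hsq := jMatrixC_mul_jMatrixC Φ
    rw [hJ, Matrix.smul_mul, Matrix.one_mul, smul_smul] at hsq
    have hcc : ((c : ℂ) * c) = -1 := by
      have e := congrFun (congrFun hsq i) i
      simpa [Matrix.smul_apply, Matrix.neg_apply] using e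
    have hreal : c * c = -1 := by exact_mod_cast hcc
    nlinarith [mul_self_nonneg c]

/-- **`h_ℂ` is injective in any dimension: `h_ℂ(z, w) = h_ℂ(z', w') ⟺ z = z' ∧ w = w'`** (`ι ≠ ∅`; the tree's
`hodgeSC_injective` is the `2 × 2` case). [cite: Moonen2004MT, (3.2) ("`S(ℂ) = ℂ^* × ℂ^*`")] [cite: MoonenZarhin1999LowDim, §2 (2.2)] -/
theorem hodgeSC_eq_hodgeSC_iff [Nonempty ι] {z w z' w' : ℂ} :
    hodgeSC Φ z w = hodgeSC Φ z' w' ↔ z = z' ∧ w = w' := by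
  refine ⟨fun h ↦ ?_, fun hzw ↦ by rw [hzw.1, hzw.2]⟩
  have h0 : hodgeSC Φ (z - z') (w - w') = 0 := by rw [← hodgeSC_sub_hodgeSC, h, sub_self]
  rw [hodgeSC] at h0
  obtain ⟨h1, h2⟩ := (smul_one_add_smul_jMatrixC_eq_zero_iff Φ).1 h0
  have hI : (2 : ℂ) * I ≠ 0 := mul_ne_zero two_ne_zero Complex.I_ne_zero
  have h1' : z - z' + (w - w') = 0 := by
    rcases div_eq_zero_iff.1 h1 with h1 | h1
    · exact h1
    · exact absurd h1 two_ne_zero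
  have h2' : z - z' - (w - w') = 0 := by
    rcases div_eq_zero_iff.1 h2 with h2 | h2
    · exact h2
    · exact absurd h2 hI
  constructor
  · linear_combination (h1' + h2') / 2
  · linear_combination (h1' - h2') / 2

/-- **A REAL value of `h_ℂ` is `h_ℂ(z, z̄)`: `h_ℂ(z, w) = X ⊗ 1 ⟹ w = z̄`** (conjugating the entries swaps `z, w` since `J`
is real: `\overline{h_ℂ(z, w)} = h_ℂ(w̄, z̄)`; then §1 injectivity). [cite: Moonen2004MT, (3.2) ("on real points … `(z, z̄)`")]
[cite: Deligne1982HodgeCycles, I §3 ("the complex conjugate `μ̄`")] -/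
theorem eq_conj_of_hodgeSC_eq_map_ofRealHom [Nonempty ι] {z w : ℂ} {X : Matrix ι ι ℝ}
    (h : hodgeSC Φ z w = X.map Complex.ofRealHom) : w = conj z := by
  have hc : (hodgeSC Φ z w).map (starRingEnd ℂ) = hodgeSC Φ z w := by
    rw [h, Matrix.map_map]
    congr 1
    funext x
    exact Complex.conj_ofReal x
  rw [map_conj_hodgeSC] at hc
  have hz := ((hodgeSC_eq_hodgeSC_iff Φ).1 hc).1
  rw [← hz, Complex.conj_conj]

/-- **`h_ℂ(z, w) = X ⊗ 1 ⟺ w = z̄ ∧ X = h(z)`.** [cite: Moonen2004MT, (3.2)] [cite: Deligne1982HodgeCycles, I §3] -/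
theorem hodgeSC_eq_map_ofRealHom_iff [Nonempty ι] {z w : ℂ} {X : Matrix ι ι ℝ} :
    hodgeSC Φ z w = X.map Complex.ofRealHom ↔ w = conj z ∧ X = hodgeS Φ z := by
  constructor
  · intro h
    have hw := eq_conj_of_hodgeSC_eq_map_ofRealHom Φ h
    refine ⟨hw, ?_⟩
    rw [hw, hodgeSC_conj] at h
    exact (Matrix.map_injective Complex.ofReal_injective h).symm
  · rintro ⟨rfl, rfl⟩
    exact hodgeSC_conj Φ z

/-- **`α · ν(u) = h_ℂ(αu, αu⁻¹)`** on matrices (`α · 1 = h_ℂ(α, α)`, `ν(u) = h_ℂ(u, u⁻¹)`). [cite: Moonen2004MT, (3.2)]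
[cite: Lange2023AbelianVarietiesComplex, §7.2.1 Remark 7.2.2 (2)] -/
theorem smul_complexCircle_eq_hodgeSC (α u : ℂ) : α • complexCircle Φ u = hodgeSC Φ (α * u) (α * u⁻¹) := by
  rw [hodgeSC_mul, hodgeSC_self, hodgeSC_inv, smul_one_mul]

end HodgeSC

/-! ## §2 The real Mumford–Tate group of `E × ∏ₖ X_k` -/

section Mixed

variable (Φ₀ : (Fin 2 → ℝ) ≃L[ℝ] ℂ)
  {κ : Type*} [Fintype κ] [DecidableEq κ] {σ : κ → Type*} [∀ k, Fintype (σ k)] [∀ k, DecidableEq (σ k)]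
  {F : κ → Type*} [∀ k, NormedAddCommGroup (F k)] [∀ k, NormedSpace ℂ (F k)] [∀ k, FiniteDimensional ℂ (F k)]
  (Ψ : ∀ k, (σ k → ℝ) ≃L[ℝ] F k) {R : Type*} [Fintype R] [DecidableEq R] {d : κ → R}

omit [Fintype κ] [DecidableEq κ] [∀ k, DecidableEq (σ k)] [Fintype R] [DecidableEq R] in
/-- Positive-dimensional factors have non-empty index types (`|σ k| = 2 dim X_k`). [folklore] -/
private theorem nonempty_index_of_finrank_pos_mixed (Ψ : ∀ k, (σ k → ℝ) ≃L[ℝ] F k) (hg : ∀ k, 0 < finrank ℂ (F k))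
    (k : κ) : Nonempty (σ k) := by
  rw [← Fintype.card_pos_iff, card_eq_two_mul_finrank (Ψ k)]
  exact Nat.mul_pos two_pos (hg k)

/-- **THE REAL MUMFORD–TATE GROUP OF THE MIXED FAMILY.** For a one-dimensional torus `E` with `End_ℚ(E) = ℚ` and
positive-dimensional tori `X_k` on the Hodge-circle locus with a `Hom`-colouring `d : κ → R`:
**`g ∈ MT(E × ∏ₖ X_k)(ℝ) ⟺ g = (B 0; 0 diag_k h_k(z_{d(k)}))` with `B ∈ M₂(ℝ)`, `z ∈ ℂ^R` and `det B = |z_i|²` for every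
class `i`** (so `det B > 0` and all `|z_i|` agree as soon as `R ≠ ∅`; for `κ = ∅` it reads `MT(E)(ℝ) = GL₂(ℝ)`). The real
form of g35-#5's `MT(ℂ) = ℂ^× · (SL₂(ℂ) × 𝔾_m(ℂ)^R)`: a real `α · h_{ℂ,k}(u, u⁻¹) = h_{ℂ,k}(αu, αu⁻¹)` must be `h_k(z) ⊗ 1` with
`z = αu`, `α² = |z|² = det(αA)`. [cite: Imai1976HodgeGroups, §2 Proposition (last case, p. 370 L10–L19) and §3 Remarks (p. 370 L38–L40)]
[cite: MoonenZarhin1999LowDim, §3 Theorem (2) and §2 (2.2)] [cite: Lange2023AbelianVarietiesComplex, §7.2.1 Remark 7.2.2 (2)]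
[cite: CarlsonMullerStachPeters2017, §15.2 Problem 15.2.3 (a), (c)] -/
theorem mem_mumfordTateGroup_prod_sigmaPiPeriod_iff_exists_of_homColouring (hE : endAlgRat Φ₀ = ⊥)
    (hg : ∀ k, 0 < finrank ℂ (F k))
    (h : ∀ k, (hodgeGroup (Ψ k) : Set (SpecialLinearGroup (σ k) ℝ)) = Set.range (hodgeCircleSL (Ψ k)))
    (hd : ∀ k l, d k = d l ↔ homRat (Ψ k) (Ψ l) ≠ ⊥) (hsurj : Surjective d) {g : GL (Fin 2 ⊕ Σ k, σ k) ℝ} :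
    g ∈ mumfordTateGroup (prodPeriod Φ₀ (sigmaPiPeriod Ψ)) ↔ ∃ (B : Matrix (Fin 2) (Fin 2) ℝ) (z : R → ℂ),
      (∀ i, B.det = ‖z i‖ ^ 2) ∧ (g : Matrix (Fin 2 ⊕ Σ k, σ k) (Fin 2 ⊕ Σ k, σ k) ℝ) =
        Matrix.fromBlocks B 0 0 (Matrix.blockDiagonal' fun k ↦ hodgeS (Ψ k) (z (d k))) := by
  haveI : ∀ k, Nonempty (σ k) := nonempty_index_of_finrank_pos_mixed Ψ hg
  rw [← map_ofRealHom_mem_mumfordTateGroupC_iff,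
    mem_mumfordTateGroupC_prod_sigmaPiPeriod_iff_exists_of_homColouring Φ₀ Ψ hE hg h hd hsurj]
  -- the matrix of `α · (A 0; 0 diag_k ν_k(u_{d(k)}))`
  have key : ∀ (α : ℂˣ) (A : SL(2, ℂ)) (u : R → ℂˣ),
      ((Matrix.GeneralLinearGroup.scalar (Fin 2 ⊕ Σ k, σ k) α * Matrix.SpecialLinearGroup.toGL
          (blockDiagC (Fin 2) (Σ k, σ k) (A, sigmaBlockDiagSL σ ℂ fun k ↦ complexCircleHom (Ψ k) (u (d k)))) :
            GL (Fin 2 ⊕ Σ k, σ k) ℂ) : Matrix (Fin 2 ⊕ Σ k, σ k) (Fin 2 ⊕ Σ k, σ k) ℂ) =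
        Matrix.fromBlocks ((α : ℂ) • A.1) 0 0
          (Matrix.blockDiagonal' fun k ↦ hodgeSC (Ψ k) (α * u (d k)) (α * (u (d k) : ℂ)⁻¹)) := by
    intro α A u
    have hf : ((α : ℂ) • fun k ↦ ((complexCircleHom (Ψ k) (u (d k)) : SpecialLinearGroup (σ k) ℂ) :
        Matrix (σ k) (σ k) ℂ)) = fun k ↦ hodgeSC (Ψ k) (α * u (d k)) (α * (u (d k) : ℂ)⁻¹) :=
      funext fun k ↦ by rw [Pi.smul_apply, coe_complexCircleHom, smul_complexCircle_eq_hodgeSC]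
    rw [coe_scalar_mul_toGL, coe_blockDiagC, coe_sigmaBlockDiagSL, Matrix.fromBlocks_smul, smul_zero, smul_zero,
      ← Matrix.blockDiagonal'_smul, hf]
  constructor
  · rintro ⟨α, A, u, hgeq⟩
    have hmat := congrArg Units.val hgeq
    rw [coe_generalLinearGroup_map_ofRealHom, key, ← Matrix.fromBlocks_toBlocks (g : Matrix (Fin 2 ⊕ Σ k, σ k) (Fin 2 ⊕ Σ k, σ k) ℝ), Matrix.fromBlocks_map,
      Matrix.fromBlocks_inj] at hmat
    obtain ⟨h11, h12, h21, h22⟩ := hmat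
    -- the locus blocks are real: `α u_i⁻¹ = conj (α u_i)`
    have hreal : ∀ i, (α : ℂ) * (u i : ℂ)⁻¹ = conj ((α : ℂ) * u i) := fun i ↦ by
      obtain ⟨k, hk⟩ := hsurj i
      have hk22 := congrArg (fun M ↦ Matrix.blockDiag' M k) h22
      simp only [Matrix.blockDiag'_map, Matrix.blockDiag'_blockDiagonal', hk] at hk22
      exact eq_conj_of_hodgeSC_eq_map_ofRealHom (Ψ k) hk22.symm
    have hsq : ∀ i, (α : ℂ) ^ 2 = ((‖(α : ℂ) * u i‖ ^ 2 : ℝ) : ℂ) := fun i ↦ by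
      rw [← Complex.normSq_eq_norm_sq, ← Complex.mul_conj, ← hreal i, mul_mul_mul_comm, mul_inv_cancel₀ (u i).ne_zero,
        mul_one, sq]
    refine ⟨(g : Matrix (Fin 2 ⊕ Σ k, σ k) (Fin 2 ⊕ Σ k, σ k) ℝ).toBlocks₁₁, fun i ↦ α * u i, fun i ↦ ?_, ?_⟩
    · -- `det g₁₁ = α² = |z_i|²`
      apply Complex.ofReal_injective
      rw [← det_map_ofRealHom, h11, Matrix.det_smul, A.2, mul_one, Fintype.card_fin, hsq i]
    · -- `X ↦ X ⊗ 1` is injective on real matrices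
      have h12' : (g : Matrix (Fin 2 ⊕ Σ k, σ k) (Fin 2 ⊕ Σ k, σ k) ℝ).toBlocks₁₂ = 0 :=
        Matrix.map_injective Complex.ofReal_injective (h12.trans (Matrix.map_zero _ (map_zero Complex.ofRealHom)).symm)
      have h21' : (g : Matrix (Fin 2 ⊕ Σ k, σ k) (Fin 2 ⊕ Σ k, σ k) ℝ).toBlocks₂₁ = 0 :=
        Matrix.map_injective Complex.ofReal_injective (h21.trans (Matrix.map_zero _ (map_zero Complex.ofRealHom)).symm)
      have hfun : (fun k ↦ hodgeSC (Ψ k) ((α : ℂ) * u (d k)) ((α : ℂ) * (u (d k) : ℂ)⁻¹)) =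
          fun k ↦ (hodgeS (Ψ k) ((α : ℂ) * u (d k))).map Complex.ofRealHom :=
        funext fun k ↦ by rw [hreal (d k), hodgeSC_conj]
      have h22' : (g : Matrix (Fin 2 ⊕ Σ k, σ k) (Fin 2 ⊕ Σ k, σ k) ℝ).toBlocks₂₂ = Matrix.blockDiagonal' fun k ↦ hodgeS (Ψ k) ((α : ℂ) * u (d k)) :=
        Matrix.map_injective Complex.ofReal_injective
          (h22.trans (by rw [hfun, ← Matrix.blockDiagonal'_map _ _ (map_zero Complex.ofRealHom)]; rfl))
      conv_lhs => rw [← Matrix.fromBlocks_toBlocks (g : Matrix (Fin 2 ⊕ Σ k, σ k) (Fin 2 ⊕ Σ k, σ k) ℝ)]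
      rw [h12', h21', h22']
  · rintro ⟨B, z, hdet, hgmat⟩
    -- `det B ≠ 0`, hence all `z_i ≠ 0`
    have hgdet : (g : Matrix (Fin 2 ⊕ Σ k, σ k) (Fin 2 ⊕ Σ k, σ k) ℝ).det ≠ 0 := ((Matrix.isUnit_iff_isUnit_det _).1 (Units.isUnit g)).ne_zero
    rw [hgmat, Matrix.det_fromBlocks_zero₂₁] at hgdet
    have hB : B.det ≠ 0 := left_ne_zero_of_mul hgdet
    have hz : ∀ i, z i ≠ 0 := fun i h0 ↦ hB (by rw [hdet i, h0, norm_zero, zero_pow two_ne_zero])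
    -- `α² = det B`, `A = α⁻¹ B`, `u_i = z_i / α`
    obtain ⟨α, hα⟩ := IsAlgClosed.exists_pow_nat_eq ((B.det : ℝ) : ℂ) two_pos
    have hα0 : α ≠ 0 := fun h0 ↦ hB (Complex.ofReal_eq_zero.1 (by rw [← hα, h0, zero_pow two_ne_zero]))
    have hdetA : ((α⁻¹ : ℂ) • B.map Complex.ofRealHom).det = 1 := by
      rw [Matrix.det_smul, det_map_ofRealHom, Fintype.card_fin, ← hα, inv_pow, inv_mul_cancel₀ (pow_ne_zero 2 hα0)]
    have hconj : ∀ i, α * (z i / α)⁻¹ = conj (z i) := fun i ↦ by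
      have hzz : z i * conj (z i) = α ^ 2 := by
        rw [Complex.mul_conj, Complex.normSq_eq_norm_sq, hα, hdet i]
      rw [inv_div, mul_div_assoc', ← sq, ← hzz, mul_div_cancel_left₀ _ (hz i)]
    set u : R → ℂˣ := fun i ↦ Units.mk0 (z i / α) (div_ne_zero (hz i) hα0) with hu
    have hu' : ∀ i, (u i : ℂ) = z i / α := fun i ↦ rfl
    refine ⟨Units.mk0 α hα0, ⟨_, hdetA⟩, u, Units.ext ?_⟩
    rw [coe_generalLinearGroup_map_ofRealHom, key, hgmat, Matrix.fromBlocks_map, Matrix.map_zero _ (map_zero _),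
      Matrix.map_zero _ (map_zero _), Matrix.blockDiagonal'_map _ _ (map_zero Complex.ofRealHom), Units.val_mk0]
    have hA : ((⟨(α⁻¹ : ℂ) • B.map Complex.ofRealHom, hdetA⟩ : SL(2, ℂ)) : Matrix (Fin 2) (Fin 2) ℂ) =
        (α⁻¹ : ℂ) • B.map Complex.ofRealHom := rfl
    have hfun : (fun k ↦ (hodgeS (Ψ k) (z (d k))).map Complex.ofRealHom) =
        fun k ↦ hodgeSC (Ψ k) (α * u (d k)) (α * (u (d k) : ℂ)⁻¹) :=
      funext fun k ↦ by rw [hu', mul_div_cancel₀ _ hα0, hconj, hodgeSC_conj]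
    rw [hA, smul_smul, mul_inv_cancel₀ hα0, one_smul, hfun]

/-- `E_τ` with `End(E_τ) = ℤ`: **`g ∈ MT(E_τ × ∏ₖ X_k)(ℝ) ⟺ g = (B 0; 0 diag_k h_k(z_{d(k)}))`, `det B = |z_i|²`.**
[cite: Imai1976HodgeGroups, §3 Remarks (p. 370 L38–L40)] [cite: MoonenZarhin1999LowDim, §3 Theorem (2)] -/
theorem mem_mumfordTateGroup_ellipticPeriod_prod_sigmaPiPeriod_iff_of_eq_bot {τ : ℂ} (hτ : τ.im ≠ 0)
    (hbot : ellipticEnd hτ = ⊥) (hg : ∀ k, 0 < finrank ℂ (F k))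
    (h : ∀ k, (hodgeGroup (Ψ k) : Set (SpecialLinearGroup (σ k) ℝ)) = Set.range (hodgeCircleSL (Ψ k)))
    (hd : ∀ k l, d k = d l ↔ homRat (Ψ k) (Ψ l) ≠ ⊥) (hsurj : Surjective d) {g : GL (Fin 2 ⊕ Σ k, σ k) ℝ} :
    g ∈ mumfordTateGroup (prodPeriod (ellipticPeriod hτ) (sigmaPiPeriod Ψ)) ↔ ∃ (B : Matrix (Fin 2) (Fin 2) ℝ) (z : R → ℂ),
      (∀ i, B.det = ‖z i‖ ^ 2) ∧ (g : Matrix (Fin 2 ⊕ Σ k, σ k) (Fin 2 ⊕ Σ k, σ k) ℝ) =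
        Matrix.fromBlocks B 0 0 (Matrix.blockDiagonal' fun k ↦ hodgeS (Ψ k) (z (d k))) :=
  mem_mumfordTateGroup_prod_sigmaPiPeriod_iff_exists_of_homColouring (ellipticPeriod hτ) Ψ
    ((endAlgRat_ellipticPeriod_eq_bot_iff hτ).2 hbot) hg h hd hsurj

end Mixed

end ComplexTorus

end Literature.Geometry.Kaehler

end
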